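import Summits.Ventures.GridStability.Lyapunov.WSCC9LossySlab7495Ball
import Literature.MathematicalPhysics.PowerSystems.LuriePostnikovSlabPositivity
import Literature.Computation.Certificates.PosSemidefDecide
import HarnessLib

/-!
# «#35‴-LEVEL+ (LP)» — the «#35‴ LANE-V-7.495°» certificate re-read through Lur'e–Postnikov POSITIVITY:
# the SAME exact object certifies a 60× LARGER LEVEL (`c = 7037309/2³⁰ ≈ 6.55·10⁻³` instead of
# `c_rk ≈ 1.089·10⁻⁴`) and a 7.76× larger Euclidean inner ball (`√ϱ ≈ 4.90°` instead of `0.632°`) — no solver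

Cell `gridfusion` (LADDER-GRIDFUSION G2.c lossy tier, lane V); seat gridfusion-lit-6 (g8); an INSTANCE of lit-6's
`Literature/MathematicalPhysics/PowerSystems/LuriePostnikovSlabPositivity.lean` (`LPSlabCertificate`,
`SlabCertificate.toLP`, `LPSlabCertificate.lt_V_of_mem_frontier_slab`) on a LOSSY row, in the shape of the SP-lane
instance `Bench/WSCC9SP9SlabLevelLP.lean` («#45-LEVEL+ (LP)»). The Lur'e–Postnikov function
`V = xᵀPx + 2Σ λ_k ∫₀^{y_k} F_k` of the rider's certificate `WSCC9LossySlab7495.cert` (files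
`WSCC9LossySlab7495{Data,,Roa,Ball}.lean`; UNCHANGED) is minorised on the closed slab not only by `xᵀPx` (class of
record, rank-one level `c_rk = cQ`) but by `xᵀ(P + Cᵀ·diag(λ_k a_k)·C)x` (`LPSlabCertificate.le_V_of_slab`: each
Popov integral is at least `(a_k/2)·y_k²` on the window — Khalil §7.1 loop transformation; Pai §4.6 (4.46)
`M₁ = ℓ₁²/cᵀP⁻¹c + q∫₀^{ℓ₁}φ`). On this object the six active directed channels carry `λ_k a_k ∈ [0.047, 0.198]`
and the two directions `(p,q)`, `(q,p)` of a line share the face `|σ_p − σ_q| = γ`, so the LOWER MATRIX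
`L = P + Cᵀ·diag(λa)·C` collects BOTH directions' Popov terms on every face (the three diagonal channels have
`C_k = 0`, `λ_k = 0`). Rank-one facts against `L` — `s_k·L − C_kᵀC_k ⪰ 0` with the dyadic `s_k` below (nine
5 × 5 `LDLᵀ`, decided in the kernel from the row's tree literals `Pq`, `lamQ`, `aQ`, `Crow` BY NAME; no producer
object) — put every level `c` with `c·s_k < γ_lo²` below `V` on the slab's faces, hence «#35‴»'s sentence
(`lossy_slab_roa` of `WSCC9LossySlab7495Roa.lean`) holds VERBATIM with the level `cLQ = 7037309/2³⁰ ≈ 6.554·10⁻³`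
in place of `c_rk = 716699207315223/6578897890000000000 ≈ 1.089·10⁻⁴` (ratio 60.16; lit-6 seat arithmetic, exact
rationals, re-decided below: optimal `s_k = C_k L⁻¹ C_kᵀ ∈ {2.4835, 2.5968, 2.4763}` against `L` versus
`{12.5, 156.9, 156.6}` against `P`; the §7 rank-one + Popov face bound of ONE direction only would give
`≈ 9.13·10⁻⁴`, ratio 8.4). With «#35‴-BALL»'s upper fact `t_W·1 − (P + Cᵀ·diag(λb)·C) ⪰ 0`, `t_W = 939581/2²⁰`
(`WSCC9LossySlab7495Ball.tW_psd`, BY NAME) the certified Euclidean inner ball of the enlarged well has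
`ϱ = 125658621/2³⁴ ≈ 7.31·10⁻³` (`√ϱ ≈ 0.0855 rad ≈ 4.90°`; «#35‴-BALL»: `√(c_rk/t_W) ≈ 0.632°`).

WHAT IS DECIDED / PROVED HERE: `LloQ` (the lower matrix over `ℚ` on the state type `Fin 3 ⊕ Fin 2`), `sLQ`/`sLK`,
`cLQ`, `rhoLQ`; `rkL_ldl` (the nine rank-one `LDLᵀ` facts, kernel), `levelL_tests`, `ballL_tests` (closed rational
inequalities, kernel), `levelL_ratio` (`60 < cLQ/c_rk`); `lowerMatrix_eq_LloQ` (cast plumbing), `lower_rankOne`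
(the nine PSD facts over `ℝ`), `hfrL` (the face hypothesis at level `cLQ`), `lossy_slab_roa_levelL` («#35‴»'s
sentence at level `cLQ`), `ball_subset_well_levelL` and `lossy_slab_roa_of_ball_levelL`.

THREE COLUMNS. CERTIFIED (kernel): for the MODEL M′ = `WSCC9.postB_SPdamp.toModel` read in `WSCC9.lurieSystem`
(as ★ #35 / «#35‴»: Kron-reduced WSCC9 post-fault-B WITH transfer conductances as printed, printed damping) and
CLASS = the rider's slab + Popov certificate at the window `2·arctan(131/2000)` with the LEVEL `cLQ` of the SAME
`V`: the region sentence and the inner ball; inner estimates (sufficient, not sharp). VALIDATED: any rendering in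
degrees. MODELLED: as ★ #35 (MV-2 + MV-P + MV-SPD + MV-h12). No sentence of this file says a grid is stable.
[cite: Khalil2002, §7.1.2 Theorem 7.3 with §7.1 Example 7.5; Pai1981, §2.16 Theorem [18] eqs. (2.63)–(2.64) and §4.6 eqs. (4.45)–(4.46); VuTuritsyn2017, §4.3 Theorem 1 with eq. (V_min); Khalil2002, Theorem 4.10 (hypothesis (4.25))]
-/

noncomputable section

open Real Set Filter Matrix
open scoped Topology
open Literature.MathematicalPhysics.PowerSystems
open Literature.MathematicalPhysics.PowerSystems.LyapunovFunctionFamily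
open Literature.Computation.Certificates
open Summit.Ventures.GridStability.Models
open Summit.Ventures.GridStability.Lyapunov.WSCC9LossySlab (e1 eκ CQ C_eq)

namespace Summit.Ventures.GridStability.Lyapunov.WSCC9LossySlab7495

/-! ### The new literals (all dyadic; lit-6 seat arithmetic, re-decided below) -/

/-- Per-channel rank-one constants against the LOWER matrix: dyadic upper bounds (margin ≈ 0.4 %) of
`C_k (P + Cᵀ·diag(λa)·C)⁻¹ C_kᵀ` on the six active channels; `1` on the three diagonal channels (`C_k = 0`). -/
def sLQ : Fin 9 → ℚ := ![1, 5107/2048, 10679/4096, 5107/2048, 1, 1273/512, 10679/4096, 1273/512, 1]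

/-- `s_k` on the typed channel index. -/
def sLK (k : Fin 3 × Fin 3) : ℚ := sLQ (eκ k)

/-- The enlarged level `cLQ = 7037309/2³⁰ ≈ 6.554·10⁻³` (largest `2⁻³⁰`-multiple with `c·s_k < γ_lo²` on all
nine channels, `γ_lo = 130719/10⁶`). -/
def cLQ : ℚ := (7037309 : ℚ) / 1073741824

/-- The enlarged ball's radius² `ϱ = 125658621/2³⁴ ≈ 7.314·10⁻³` (`t_W·ϱ ≤ cLQ`, `2ϱ < γ_lo²`). -/
def rhoLQ : ℚ := (125658621 : ℚ) / 17179869184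

/-- **The LOWER comparison matrix over `ℚ`** on the state type: `L = P + Cᵀ·diag(λ_k a_k)·C`. -/
def LloQ : Matrix (Fin 3 ⊕ Fin 2) (Fin 3 ⊕ Fin 2) ℚ :=
  PQ + CQᵀ * Matrix.diagonal (fun k => lamK k * aK k) * CQ

/-! ### Kernel decisions -/

set_option maxHeartbeats 4000000 in
/-- **The nine rank-one facts against the lower matrix**: `s_k·L − C_kᵀC_k ⪰ 0` (5 × 5 `LDLᵀ` each, decided
in the kernel; on the diagonal channels this is `L ⪰ 0`). -/
theorem rkL_ldl : ∀ k : Fin 3 × Fin 3, PSD.LDLCert ((sLK k • LloQ - Matrix.vecMulVec (CQ k) (CQ k)).submatrix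
    e1.symm e1.symm) := by
  decide +kernel

/-- The level tests: `s_k > 0` and `cLQ·s_k < γ_lo²` on every channel. -/
theorem levelL_tests : (∀ k : Fin 3 × Fin 3, 0 < sLK k) ∧ ∀ k : Fin 3 × Fin 3, cLQ * sLK k < gammaLoQ ^ 2 := by
  constructor <;> decide +kernel

/-- The ball tests: `t_W·ϱ ≤ cLQ` and `(C_kᵀC_k)·ϱ < γ_lo²` on every channel (`C_kᵀC_k ∈ {0, 1, 2}`). -/
theorem ballL_tests : tWQ * rhoLQ ≤ cLQ ∧ ∀ k : Fin 3 × Fin 3, (CQ k ⬝ᵥ CQ k) * rhoLQ < gammaLoQ ^ 2 := by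
  refine ⟨by norm_num [tWQ, rhoLQ, cLQ], ?_⟩
  decide +kernel

/-- **The level ratio of record** (kernel): `cLQ` exceeds `60 ×` the rider's rank-one level `c_rk = cQ`. -/
theorem levelL_ratio : (60 : ℚ) < cLQ / cQ := by norm_num [cLQ, cQ]

/-! ### Cast plumbing -/

/-- `(M·N) ↦ ℝ` (plumbing). -/
private theorem map_mul' {m n o : Type*} [Fintype n] (M : Matrix m n ℚ) (N : Matrix n o ℚ) :
    (M * N).map (Rat.cast : ℚ → ℝ) = M.map (Rat.cast : ℚ → ℝ) * N.map (Rat.cast : ℚ → ℝ) :=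
  Matrix.map_mul (f := Rat.castHom ℝ)
/-- `(M+N) ↦ ℝ` (plumbing). -/
private theorem map_add' {m n : Type*} (M N : Matrix m n ℚ) :
    (M + N).map (Rat.cast : ℚ → ℝ) = M.map (Rat.cast : ℚ → ℝ) + N.map (Rat.cast : ℚ → ℝ) := by
  ext i j; simp
/-- `(M−N) ↦ ℝ` (plumbing). -/
private theorem map_sub' {m n : Type*} (M N : Matrix m n ℚ) :
    (M - N).map (Rat.cast : ℚ → ℝ) = M.map (Rat.cast : ℚ → ℝ) - N.map (Rat.cast : ℚ → ℝ) := by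
  ext i j; simp
/-- transpose commutes with the cast (plumbing). -/
private theorem map_transpose' {m n : Type*} (M : Matrix m n ℚ) :
    Mᵀ.map (Rat.cast : ℚ → ℝ) = (M.map (Rat.cast : ℚ → ℝ))ᵀ := rfl
/-- `diag(d) ↦ ℝ` (plumbing). -/
private theorem map_diagonal' {n : Type*} [DecidableEq n] (d : n → ℚ) :
    (Matrix.diagonal d).map (Rat.cast : ℚ → ℝ) = Matrix.diagonal (fun i => (d i : ℝ)) :=
  Matrix.diagonal_map Rat.cast_zero
/-- `(q • M) ↦ ℝ` (plumbing). -/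
private theorem map_smul' {m n : Type*} (q : ℚ) (M : Matrix m n ℚ) :
    (q • M).map (Rat.cast : ℚ → ℝ) = (q : ℝ) • M.map (Rat.cast : ℚ → ℝ) := by
  ext i j; simp
/-- `vecMulVec` commutes with the cast (plumbing). -/
private theorem map_vecMulVec' {m n : Type*} (u : m → ℚ) (v : n → ℚ) :
    (Matrix.vecMulVec u v).map (Rat.cast : ℚ → ℝ)
      = Matrix.vecMulVec (fun i => (u i : ℝ)) (fun j => (v j : ℝ)) := by
  ext i j; simp [Matrix.vecMulVec]

/-- **The certificate's LOWER comparison matrix IS `LloQ ↦ ℝ`** (`cert.toLP.lowerMatrix = P + Cᵀ·diag(λa)·C`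
by `SlabCertificate.toLP_lowerMatrix`, then casts). -/
theorem lowerMatrix_eq_LloQ : cert.toLP.lowerMatrix = LloQ.map (Rat.cast : ℚ → ℝ) := by
  have hd : Matrix.diagonal (fun k => cert.lam k * cert.a k)
      = (Matrix.diagonal (fun k => lamK k * aK k)).map (Rat.cast : ℚ → ℝ) := by
    rw [map_diagonal', cert_lam, cert_a]; congr 1; funext k; simp only [lam, a]; push_cast; ring
  rw [SlabCertificate.toLP_lowerMatrix, hd, cert_P, C_eq, P, LloQ]
  simp only [map_add', map_mul', map_transpose']

/-- A channel row of `C` over `ℝ` is the cast of the `ℚ` row (plumbing). -/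
private theorem C_row_cast (k : Fin 3 × Fin 3) : WSCC9.lurieSystem.C k = fun i => ((CQ k i : ℚ) : ℝ) := by
  funext i
  rw [C_eq]
  rfl

/-- **The nine rank-one facts over `ℝ` against the certificate's lower matrix.** -/
theorem lower_rankOne (k : Fin 3 × Fin 3) :
    (((sLK k : ℚ) : ℝ) • cert.toLP.lowerMatrix
      - Matrix.vecMulVec (WSCC9.lurieSystem.C k) (WSCC9.lurieSystem.C k)).PosSemidef := by
  have hq : ((sLK k : ℚ) : ℝ) • cert.toLP.lowerMatrix
      - Matrix.vecMulVec (WSCC9.lurieSystem.C k) (WSCC9.lurieSystem.C k)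
      = (sLK k • LloQ - Matrix.vecMulVec (CQ k) (CQ k)).map (Rat.cast : ℚ → ℝ) := by
    rw [lowerMatrix_eq_LloQ, C_row_cast, map_sub', map_smul', map_vecMulVec']
  rw [hq]
  have h := ((rkL_ldl k).posSemidef (R := ℝ)).submatrix e1
  have e2 : (((sLK k • LloQ - Matrix.vecMulVec (CQ k) (CQ k)).submatrix ⇑e1.symm ⇑e1.symm).map
      (Rat.cast : ℚ → ℝ)).submatrix e1 e1
      = (sLK k • LloQ - Matrix.vecMulVec (CQ k) (CQ k)).map (Rat.cast : ℚ → ℝ) := by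
    ext i j; simp
  rwa [e2] at h

/-! ### The face hypothesis at the enlarged level, and «#35‴»'s sentence at that level -/

/-- **The face hypothesis `hfr` at level `cLQ`**: `cLQ < V` on the frontier of the slab
`|σ_k − δ*_k| < 2·arctan(131/2000)` — lit-6's `LPSlabCertificate.lt_V_of_mem_frontier_slab` applied to
`cert.toLP` with the lower rank-one facts, the decided tests `cLQ·s_k < γ_lo²` and `γ_lo < 2·arctan(131/2000)`. -/
theorem hfrL : ∀ x ∈ frontier (WSCC9.lurieSystem.slab (fun _ => 2 * Real.arctan (131 / 2000))),
    ((cLQ : ℚ) : ℝ) < cert.V x := by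
  intro x hx
  have hs0 : ∀ k : Fin 3 × Fin 3, (0 : ℝ) < ((sLK k : ℚ) : ℝ) := fun k => by exact_mod_cast levelL_tests.1 k
  have h0 : (0 : ℝ) ≤ ((gammaLoQ : ℚ) : ℝ) := by exact_mod_cast gammaLo_test.1
  have hsq : ((gammaLoQ : ℚ) : ℝ) ^ 2 < (2 * Real.arctan (131 / 2000)) ^ 2 :=
    pow_lt_pow_left₀ gammaLo_lt_window h0 two_ne_zero
  have hc' : ∀ k : Fin 3 × Fin 3, ((cLQ : ℚ) : ℝ) < (2 * Real.arctan (131 / 2000)) ^ 2 / ((sLK k : ℚ) : ℝ) := by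
    intro k
    rw [lt_div_iff₀ (hs0 k)]
    have h1 : ((cLQ : ℚ) : ℝ) * ((sLK k : ℚ) : ℝ) < ((gammaLoQ : ℚ) : ℝ) ^ 2 := by
      exact_mod_cast levelL_tests.2 k
    exact h1.trans hsq
  have h := cert.toLP.lt_V_of_mem_frontier_slab (γ := fun _ => 2 * Real.arctan (131 / 2000))
    hsec hs0 lower_rankOne hc' hx
  rwa [SlabCertificate.toLP_V] at h

/-- **«#35‴-LEVEL+ (LP)» — «#35‴ LANE-V-7.495°»'s certified region at the ENLARGED level `cLQ = 7037309/2³⁰`.**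
MODEL M′ = `WSCC9.postB_SPdamp.toModel` (WSCC9 post-fault-B classical model, Kron reduction WITH transfer
conductances as printed, printed damping), read in the directed Lur'e presentation `WSCC9.lurieSystem`;
CLASS = the rider's certificate `cert` (SAME `V`). For every solution `c` of M′ on `univ` whose Lur'e state starts
in the slab `|σ_k − δ*_k| < 2·arctan(131/2000)` with `V(x(0)) ≤ cLQ`: the slab and the level are kept for all
`t ≥ 0` and `x(t) → 0`. Inner estimate (60.16× the level of «#35‴» on the SAME certificate); a priori over all
solutions. No sentence here says a grid is stable.
[cite: Khalil2002, §7.1.2 Theorem 7.3 with §7.1 Example 7.5; Pai1981, §2.16 Theorem [18] and §4.6 eq. (4.46); VuTuritsyn2017, §4.3 Theorem 1 with eq. (V_min)] -/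
theorem lossy_slab_roa_levelL {c : ℝ → ClassicalSwing.State 3}
    (hc : WSCC9.postB_SPdamp.toModel.IsSolutionOn c univ)
    (h0 : WSCC9.postB_SPdamp.lurieState WSCC9.postB_SPdamp.angleOf (c 0)
      ∈ WSCC9.lurieSystem.slab (fun _ => 2 * Real.arctan (131 / 2000)))
    (h0c : cert.V (WSCC9.postB_SPdamp.lurieState WSCC9.postB_SPdamp.angleOf (c 0)) ≤ ((cLQ : ℚ) : ℝ)) :
    (∀ t, 0 ≤ t →
        WSCC9.postB_SPdamp.lurieState WSCC9.postB_SPdamp.angleOf (c t)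
            ∈ WSCC9.lurieSystem.slab (fun _ => 2 * Real.arctan (131 / 2000)) ∧
          cert.V (WSCC9.postB_SPdamp.lurieState WSCC9.postB_SPdamp.angleOf (c t)) ≤ ((cLQ : ℚ) : ℝ)) ∧
      Tendsto (fun t => WSCC9.postB_SPdamp.lurieState WSCC9.postB_SPdamp.angleOf (c t)) atTop (𝓝 0) := by
  have key := cert.well_subset_regionOfAttraction (γ := fun _ => 2 * Real.arctan (131 / 2000))
    hsec hfrL h0 h0c
  exact key.2 (fun t => WSCC9.postB_SPdamp.lurieState WSCC9.postB_SPdamp.angleOf (c t)) rfl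
    fun T t ht => WSCC9.hasDerivWithinAt_lurieState hc t

/-- **THE CERTIFIED INNER BALL of the enlarged well**: `{x : xᵀx ≤ ϱ}`, `ϱ = 125658621/2³⁴` (`√ϱ ≈ 0.0855 rad ≈
4.90°`), lies inside `{x ∈ slab(2·arctan(131/2000)) : V x ≤ cLQ}` (lit-6's `SlabCertificate.ball_subset_well` with
«#35‴-BALL»'s `t_W` fact BY NAME and the decided `ballL_tests`; the «#35‴-BALL» radius was `√(c_rk/t_W) ≈ 0.632°`).
[cite: Khalil2002, Theorem 4.10 (hypothesis (4.25)); VuTuritsyn2017, §4.3 Theorem 1 (set ℛ)] -/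
theorem ball_subset_well_levelL :
    {x : Fin 3 ⊕ Fin 2 → ℝ | x ⬝ᵥ x ≤ ((rhoLQ : ℚ) : ℝ)} ⊆
      {x | x ∈ WSCC9.lurieSystem.slab (fun _ => 2 * Real.arctan (131 / 2000)) ∧ cert.V x ≤ ((cLQ : ℚ) : ℝ)} := by
  obtain ⟨htc, hCk⟩ := ballL_tests
  have ht0 : (0 : ℝ) ≤ ((tWQ : ℚ) : ℝ) := by exact_mod_cast (show (0 : ℚ) ≤ tWQ by norm_num [tWQ])
  refine cert.ball_subset_well (γ := fun _ => 2 * Real.arctan (131 / 2000)) (fun _ => window_pos)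
    ht0 tW_psd hsec (by exact_mod_cast htc) fun k => ?_
  rw [channel_norm_eq]
  have h1 : (((CQ k ⬝ᵥ CQ k : ℚ)) : ℝ) * ((rhoLQ : ℚ) : ℝ) < ((gammaLoQ : ℚ) : ℝ) ^ 2 := by
    exact_mod_cast hCk k
  have h0 : (0 : ℝ) ≤ ((gammaLoQ : ℚ) : ℝ) := by exact_mod_cast gammaLo_test.1
  have h2 : ((gammaLoQ : ℚ) : ℝ) ^ 2 < (2 * Real.arctan (131 / 2000)) ^ 2 :=
    pow_lt_pow_left₀ gammaLo_lt_window h0 two_ne_zero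
  exact h1.trans h2

/-- **THE SENTENCE FOR THE ENLARGED BALL.** For every solution `c` of M′ whose Lur'e state `x(0) = (ω | σ − σ*)`
satisfies `x(0)ᵀx(0) ≤ ϱ = 125658621/2³⁴` (`√ϱ ≈ 0.0855`): the slab `|σ_k − δ*_k| < 2·arctan(131/2000)` and the
level `V ≤ cLQ` hold for all `t ≥ 0` and `x(t) → 0`. CERTIFIED for the MODEL; a Euclidean inner ball of an inner
estimate. No sentence here says a grid is stable.
[cite: Pai1981, §2.16 Theorem [18] and §4.6 eq. (4.46); VuTuritsyn2017, §4.3 Theorem 1; Khalil2002, Theorem 4.10] -/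
theorem lossy_slab_roa_of_ball_levelL {c : ℝ → ClassicalSwing.State 3}
    (hc : WSCC9.postB_SPdamp.toModel.IsSolutionOn c univ)
    (h0 : WSCC9.postB_SPdamp.lurieState WSCC9.postB_SPdamp.angleOf (c 0)
            ⬝ᵥ WSCC9.postB_SPdamp.lurieState WSCC9.postB_SPdamp.angleOf (c 0) ≤ ((rhoLQ : ℚ) : ℝ)) :
    (∀ t, 0 ≤ t →
        WSCC9.postB_SPdamp.lurieState WSCC9.postB_SPdamp.angleOf (c t)
            ∈ WSCC9.lurieSystem.slab (fun _ => 2 * Real.arctan (131 / 2000)) ∧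
          cert.V (WSCC9.postB_SPdamp.lurieState WSCC9.postB_SPdamp.angleOf (c t)) ≤ ((cLQ : ℚ) : ℝ)) ∧
      Tendsto (fun t => WSCC9.postB_SPdamp.lurieState WSCC9.postB_SPdamp.angleOf (c t)) atTop (𝓝 0) := by
  have hw := ball_subset_well_levelL h0
  exact lossy_slab_roa_levelL hc hw.1 hw.2

end Summit.Ventures.GridStability.Lyapunov.WSCC9LossySlab7495

end
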